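import Summits.CriticalPhenomena.PercolationContinuityZ3.Theorems.PercNearOneGluingNoHeavyLowerTailKnQuestion8CoefficientwiseOffClusterPred
import HarnessLib

/-!
# One-sided (blue-primary) cell lemma and off-cluster theorem; conjecture RZ-OS for a pendant conditioning vertex (prim-lf-2 gen 30)

Support file (`--supports stmt-CriticalPhenomena-4575`, closed), prover `prim-lf-2` (gen 30).  No definitions, no named facts, no sorries; standard axioms.
Memo `prim-lf-2/CW-ROOT-gen30.md` §6b (conjecture RZ-OS: the K̄-primary ONE-SIDED form of the restricted kernel RZ is census-clean; the K-primary one is not);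
companions `…CoefficientwiseOffClusterPred.lean` (p263680: two-sided version, `rz_pendant`), `…CoefficientwiseHarris.lean` (gen-23 cells: `fkg_cell`,
`twoColouring_cell_nonneg_of_le`).

The gen-23 cell method proves two-sided sums `Σ (F t − F tᶜ)(G t − G tᶜ) ≥ 0` cell by cell from a pointwise domination.  The same cells carry a ONE-SIDED inequality,
which is what tensorisation arguments (`Coefficientwise.kernel_tensor`) consume and what the non-symmetric restricted kernels of gen 30 need:
* `Coefficientwise.oneSided_cell_nonneg` / `oneSided_cell_nonneg_of_le` — on a cell `{t ∩ B = π}`, for monotone `F ≥ 0`, monotone `G` with `G t ≤ G((τt)ᶜ)`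
  pointwise (or just `Σ G t ≤ Σ G tᶜ`): `0 ≤ Σ_{cell} F tᶜ (G tᶜ − G t)` — Harris twice on the sublattice.
* `Coefficientwise.offCluster_oneSided_nonneg_pred` (+ `_sub`) — `0 ≤ Σ_{s : A ∩ C_x(s) = ∅, P(R_A(s))} f(C_x sᶜ)(g(C_x sᶜ) − g(C_x s))` for monotone `f ≥ 0`,
  monotone `g`, any event `P` of the red cluster of `A` (blue cluster primary; the red-primary form is false).
* (companion file `…CoefficientwiseOneSidedPendant.lean`: `Coefficientwise.rz_os_pendant` — conjecture RZ-OS for a PENDANT conditioning vertex `z`.)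
[cite: KozmaNitzan2024, Questions 8–9 (§5.5 p. 36) (context: first rung of the coefficientwise programme for Question 8)]
-/

namespace Summit.CriticalPhenomena.PercolationContinuityZ3.Theorems

open Finset Literature.Probability.Percolation

namespace Coefficientwise

variable {ι V : Type*}

section cell
variable [Fintype ι] [DecidableEq ι]

/-- **One-sided cell lemma (means form).**  On a cell `{t | t ∩ B = π}` of the cube, for monotone `F ≥ 0` and monotone `G` with
`Σ_{cell} G t ≤ Σ_{cell} G tᶜ`, the blue-primary one-sided sum is nonnegative: `0 ≤ Σ_{cell} F tᶜ · (G tᶜ − G t)`.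
(Harris/FKG on the cell twice: `F∘compl` is antitone, `G` monotone ⇒ `|cell|·Σ F tᶜ G t ≤ (Σ F tᶜ)(Σ G t) ≤ (Σ F tᶜ)(Σ G tᶜ) ≤ |cell|·Σ F tᶜ G tᶜ`.)
[cite: KozmaNitzan2024, §5.5 (context only; the inequality is Harris–Kleitman / FKG on a sublattice)] -/
theorem oneSided_cell_nonneg (B π : Finset ι) (F G : Finset ι → ℝ) (hF : Monotone F) (hG : Monotone G) (hF0 : ∀ t, 0 ≤ F t)
    (hGc : ∑ t ∈ univ.filter (fun t : Finset ι => t ∩ B = π), G t ≤ ∑ t ∈ univ.filter (fun t : Finset ι => t ∩ B = π), G tᶜ) :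
    0 ≤ ∑ t ∈ univ.filter (fun t : Finset ι => t ∩ B = π), F tᶜ * (G tᶜ - G t) := by
  set cell := univ.filter (fun t : Finset ι => t ∩ B = π) with hcell
  set Fc : Finset ι → ℝ := fun t => -F tᶜ with hFc
  set Gc : Finset ι → ℝ := fun t => -G tᶜ with hGcdef
  have hFcm : Monotone Fc := fun s t hst => by
    simp only [hFc]; linarith [hF (compl_subset_compl.mpr hst)]
  have hGcm : Monotone Gc := fun s t hst => by
    simp only [hGcdef]; linarith [hG (compl_subset_compl.mpr hst)]
  have k1 := fkg_cell B π Fc G hFcm hG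
  have k2 := fkg_cell B π Fc Gc hFcm hGcm
  have hA : 0 ≤ ∑ t ∈ cell, F tᶜ := Finset.sum_nonneg fun t _ => hF0 _
  -- unfold the auxiliary functions in the FKG inequalities
  have e1 : ∑ t ∈ cell, Fc t = -∑ t ∈ cell, F tᶜ := by simp only [hFc, Finset.sum_neg_distrib]
  have e2 : ∑ t ∈ cell, Gc t = -∑ t ∈ cell, G tᶜ := by simp only [hGcdef, Finset.sum_neg_distrib]
  have e3 : ∑ t ∈ cell, Fc t * G t = -∑ t ∈ cell, F tᶜ * G t := by
    simp only [hFc, neg_mul, Finset.sum_neg_distrib]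
  have e4 : ∑ t ∈ cell, Fc t * Gc t = ∑ t ∈ cell, F tᶜ * G tᶜ := by
    simp only [hFc, hGcdef, neg_mul_neg]
  rw [e1, e3] at k1
  rw [e1, e2, e4] at k2
  -- k1 : (-A) * ΣG ≤ N * (-Σ F tᶜ G t)  ;  k2 : (-A) * (-ΣG tᶜ) ≤ N * Σ F tᶜ G tᶜ
  have hmid : (∑ t ∈ cell, F tᶜ) * (∑ t ∈ cell, G t) ≤ (∑ t ∈ cell, F tᶜ) * (∑ t ∈ cell, G tᶜ) :=
    mul_le_mul_of_nonneg_left hGc hA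
  have hsum : ∑ t ∈ cell, F tᶜ * (G tᶜ - G t) = ∑ t ∈ cell, F tᶜ * G tᶜ - ∑ t ∈ cell, F tᶜ * G t := by
    simp only [mul_sub, Finset.sum_sub_distrib]
  rcases cell.eq_empty_or_nonempty with hce | hne
  · simp [hce]
  · have hcard : (0 : ℝ) < (cell.card : ℝ) := by exact_mod_cast hne.card_pos
    rw [hsum]
    by_contra hlt
    have hlt' : ∑ t ∈ cell, F tᶜ * G tᶜ - ∑ t ∈ cell, F tᶜ * G t < 0 := lt_of_not_ge hlt
    nlinarith [k1, k2, hmid, hcard, hlt']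

/-- Pointwise form of `oneSided_cell_nonneg`: if `π ⊆ B` and on the cell `G t ≤ G ((B \ π) ∪ (t \ B))` (the configuration with the frozen pattern reversed and
the free part kept dominates), then `0 ≤ Σ_{cell} F tᶜ (G tᶜ − G t)` for monotone `F ≥ 0`, monotone `G`.  (Reindex by the flip of the free coordinates, as in
`twoColouring_cell_nonneg_of_le`.)  [cite: KozmaNitzan2024, §5.5 (context only)] -/
theorem oneSided_cell_nonneg_of_le (B π : Finset ι) (hπ : π ⊆ B) (F G : Finset ι → ℝ) (hF : Monotone F) (hG : Monotone G)
    (hF0 : ∀ t, 0 ≤ F t) (hGle : ∀ t : Finset ι, t ∩ B = π → G t ≤ G ((B \ π) ∪ (t \ B))) :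
    0 ≤ ∑ t ∈ univ.filter (fun t : Finset ι => t ∩ B = π), F tᶜ * (G tᶜ - G t) := by
  set cell := univ.filter (fun t : Finset ι => t ∩ B = π) with hcell
  have mem_cell : ∀ t : Finset ι, t ∈ cell ↔ t ∩ B = π := fun t => by simp [hcell]
  set τ : Finset ι → Finset ι := fun t => π ∪ (tᶜ \ B) with hτ
  have facts : ∀ t : Finset ι, t ∩ B = π → ∀ i, (i ∈ π ↔ i ∈ t ∧ i ∈ B) := fun t ht i => by
    rw [← ht]; exact Finset.mem_inter
  have memτ : ∀ t i, i ∈ τ t ↔ i ∈ π ∨ (i ∉ t ∧ i ∉ B) := fun t i => by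
    simp only [hτ, Finset.mem_union, Finset.mem_sdiff, Finset.mem_compl]
  have hτcell : ∀ t, t ∩ B = π → τ t ∩ B = π := by
    intro t ht
    ext i
    simp only [Finset.mem_inter, memτ]
    have h1 := facts t ht i
    have h2 : i ∈ π → i ∈ B := fun h => hπ h
    tauto
  have hττ : ∀ t, t ∩ B = π → τ (τ t) = t := by
    intro t ht
    ext i
    rw [memτ, memτ]
    have h1 := facts t ht i
    have h2 : i ∈ π → i ∈ B := fun h => hπ h
    tauto
  have hflip : ∀ t, t ∩ B = π → tᶜ = (B \ π) ∪ (τ t \ B) := by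
    intro t ht
    ext i
    simp only [Finset.mem_compl, Finset.mem_union, Finset.mem_sdiff, memτ]
    have h1 := facts t ht i
    have h2 : i ∈ π → i ∈ B := fun h => hπ h
    tauto
  have reindex : ∀ H : Finset ι → ℝ, ∑ t ∈ cell, H tᶜ = ∑ t ∈ cell, H ((B \ π) ∪ (t \ B)) := by
    intro H
    refine Finset.sum_bij' (fun t _ => τ t) (fun t _ => τ t) ?_ ?_ ?_ ?_ ?_
    · intro t ht; exact (mem_cell _).mpr (hτcell t ((mem_cell t).mp ht))
    · intro t ht; exact (mem_cell _).mpr (hτcell t ((mem_cell t).mp ht))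
    · intro t ht; exact hττ t ((mem_cell t).mp ht)
    · intro t ht; exact hττ t ((mem_cell t).mp ht)
    · intro t ht; rw [hflip t ((mem_cell t).mp ht)]
  have hGc : ∑ t ∈ cell, G t ≤ ∑ t ∈ cell, G tᶜ := by
    rw [reindex G]
    exact Finset.sum_le_sum fun t ht => hGle t ((mem_cell t).mp ht)
  exact oneSided_cell_nonneg B π F G hF hG hF0 hGc

end cell

section pred
variable [Fintype ι] [DecidableEq ι]

open Classical in
/-- **One-sided off-cluster theorem on any event of the red cluster of `A` (prim-lf-2 gen 30).**  For a finite multigraph, a vertex `x`, a vertex set `A`, a predicate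
`P` on vertex sets, a monotone NONNEGATIVE `f` and a monotone `g`: with `R_A(s)` the red cluster of `A`,
  `0 ≤ Σ_{s : A ∩ C_x(s) = ∅, P(R_A(s))} f(C_x(sᶜ))·(g(C_x(sᶜ)) − g(C_x(s)))`
— the BLUE-primary one-sided form: tilting by any increasing nonnegative function of the blue cluster, the blue cluster of `x` still dominates the red one on every
cell of the frozen data (Harris twice on the cell + the pointwise domination `C_x(t) ⊆ C_x((τt)ᶜ)`; `oneSided_cell_nonneg_of_le`).  The red-primary form
`Σ f(C_x s)(g(C_x s) − g(C_x sᶜ))` is NOT nonnegative (memo CW-ROOT-gen30 §6b: control).  [cite: KozmaNitzan2024, Questions 8–9 (§5.5 p. 36) (context)] -/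
theorem offCluster_oneSided_nonneg_pred (ends : ι → Sym2 V) (x : V) (A : Set V) (P : Set V → Prop) (f g : Set V → ℝ)
    (hf : Monotone f) (hf0 : ∀ W, 0 ≤ f W) (hg : Monotone g) :
    0 ≤ ∑ s ∈ univ.filter (fun s : Finset ι => (∀ a ∈ A, a ∉ openCluster (ends '' (↑s : Set ι)) x) ∧
        P {y | ∃ a ∈ A, y ∈ openCluster (ends '' (↑s : Set ι)) a}),
      f (openCluster (ends '' (↑(sᶜ) : Set ι)) x) *
        (g (openCluster (ends '' (↑(sᶜ) : Set ι)) x) - g (openCluster (ends '' (↑s : Set ι)) x)) := by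
  -- notation
  set K : Finset ι → Set V := fun s => openCluster (ends '' (↑s : Set ι)) x with hK
  set F : Finset ι → ℝ := fun s => f (K s) with hF
  set G : Finset ι → ℝ := fun s => g (K s) with hG
  set D : Finset (Finset ι) := univ.filter (fun s : Finset ι => (∀ a ∈ A, a ∉ openCluster (ends '' (↑s : Set ι)) x) ∧
    P {y | ∃ a ∈ A, y ∈ openCluster (ends '' (↑s : Set ι)) a}) with hD
  change 0 ≤ ∑ s ∈ D, F sᶜ * (G sᶜ - G s)
  have hKmono : ∀ {s t : Finset ι}, s ⊆ t → K s ⊆ K t := fun hst => openCluster_image_mono ends hst x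
  have hFm : Monotone F := fun s t hst => hf (hKmono hst)
  have hGm : Monotone G := fun s t hst => hg (hKmono hst)
  -- the red cluster of the set `A`, the edges at a vertex set, and the cell key
  set R : Finset ι → Set V := fun s => {y | ∃ a ∈ A, y ∈ openCluster (ends '' (↑s : Set ι)) a} with hR
  set I : Set V → Finset ι := fun S => univ.filter (fun i : ι => ∃ v ∈ S, v ∈ ends i) with hI
  set key : Finset ι → Set V × Finset ι := fun s => (R s, s ∩ I (R s)) with hkey
  -- basic facts about `R`
  have R_closed : ∀ (s : Finset ι) {u w : V}, u ∈ R s → (openGraph (ends '' (↑s : Set ι))).Adj u w → w ∈ R s := by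
    intro s u w hu hadj
    obtain ⟨a, haA, hau⟩ := hu
    exact ⟨a, haA, SimpleGraph.Reachable.trans hau hadj.reachable⟩
  have mem_I : ∀ (S : Set V) (i : ι) (v : V), v ∈ S → v ∈ ends i → i ∈ I S := by
    intro S i v hv hvi
    simp only [hI, Finset.mem_filter, Finset.mem_univ, true_and]
    exact ⟨v, hv, hvi⟩
  have A_sub_R : ∀ (s : Finset ι), ∀ a ∈ A, a ∈ R s := fun s a ha => ⟨a, ha, mem_openCluster_self _ a⟩
  -- (L3) locality: a configuration agreeing with `s₀` on the edges at `R s₀` has the same red cluster of `A`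
  have locality : ∀ s₀ t : Finset ι, t ∩ I (R s₀) = s₀ ∩ I (R s₀) → R t = R s₀ := by
    intro s₀ t ht
    have agree : ∀ i, i ∈ I (R s₀) → (i ∈ t ↔ i ∈ s₀) := by
      intro i hi
      have := congrArg (fun u : Finset ι => i ∈ u) ht
      simp only [Finset.mem_inter, hi, and_true, eq_iff_iff] at this
      exact this
    -- transfer s₀-walks to t-walks inside `R s₀`
    have h1 : ∀ u ∈ R s₀, ∀ w, (openGraph (ends '' (↑s₀ : Set ι))).Adj u w →
        (openGraph (ends '' (↑t : Set ι))).Adj u w ∧ w ∈ R s₀ := by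
      intro u hu w hadj
      refine ⟨?_, R_closed s₀ hu hadj⟩
      rw [openGraph_image_adj] at hadj ⊢
      obtain ⟨⟨i, his, hi⟩, hne⟩ := hadj
      have hiI : i ∈ I (R s₀) := mem_I _ i u hu (by rw [hi]; exact Sym2.mem_mk_left u w)
      exact ⟨⟨i, (agree i hiI).mpr his, hi⟩, hne⟩
    -- transfer t-walks to s₀-walks inside `R s₀`
    have h2 : ∀ u ∈ R s₀, ∀ w, (openGraph (ends '' (↑t : Set ι))).Adj u w →
        (openGraph (ends '' (↑s₀ : Set ι))).Adj u w ∧ w ∈ R s₀ := by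
      intro u hu w hadj
      have hadj' : (openGraph (ends '' (↑s₀ : Set ι))).Adj u w := by
        rw [openGraph_image_adj] at hadj ⊢
        obtain ⟨⟨i, hit, hi⟩, hne⟩ := hadj
        have hiI : i ∈ I (R s₀) := mem_I _ i u hu (by rw [hi]; exact Sym2.mem_mk_left u w)
        exact ⟨⟨i, (agree i hiI).mp hit, hi⟩, hne⟩
      exact ⟨hadj', R_closed s₀ hu hadj'⟩
    ext y
    constructor
    · rintro ⟨a, haA, hay⟩
      obtain ⟨p⟩ := hay
      exact ((reachable_transfer (R s₀) h2 p) (A_sub_R s₀ a haA)).2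
    · rintro ⟨a, haA, hay⟩
      obtain ⟨p⟩ := hay
      exact ⟨a, haA, ((reachable_transfer (R s₀) h1 p) (A_sub_R s₀ a haA)).1⟩
  -- split the sum over `D` along the fibres of `key`
  rw [← Finset.sum_fiberwise_of_maps_to (s := D) (t := D.image key) (g := key)
    (fun s hs => Finset.mem_image_of_mem key hs)]
  refine Finset.sum_nonneg fun k hk => ?_
  obtain ⟨s₀, hs₀D, rfl⟩ := Finset.mem_image.mp hk
  have hs₀ : ∀ a ∈ A, a ∉ K s₀ := by
    have := (Finset.mem_filter.mp hs₀D).2.1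
    simpa [hK] using this
  have hP₀ : P (R s₀) := (Finset.mem_filter.mp hs₀D).2.2
  -- abbreviations for the frozen data of the cell of `s₀`
  set S₀ : Set V := R s₀ with hS₀
  set B : Finset ι := I S₀ with hB
  set π : Finset ι := s₀ ∩ B with hπ
  have hxS₀ : x ∉ S₀ := by
    rintro ⟨a, haA, hax⟩
    exact hs₀ a haA (SimpleGraph.Reachable.symm hax)
  -- (L4) the fibre of `key s₀` in `D` is exactly the cell `{t | t ∩ B = π}`
  have fiber_eq : D.filter (fun t => key t = key s₀) = univ.filter (fun t : Finset ι => t ∩ B = π) := by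
    ext t
    simp only [Finset.mem_filter, Finset.mem_univ, true_and]
    constructor
    · rintro ⟨_, hkt⟩
      have h1 : R t = S₀ := (Prod.ext_iff.mp hkt).1
      have h2 : t ∩ I (R t) = s₀ ∩ I (R s₀) := (Prod.ext_iff.mp hkt).2
      rw [h1] at h2
      exact h2
    · intro ht
      have hRt : R t = S₀ := locality s₀ t ht
      refine ⟨?_, ?_⟩
      · rw [hD, Finset.mem_filter]
        refine ⟨Finset.mem_univ _, fun a haA hax => ?_, ?_⟩
        · have hxRt : x ∈ R t := ⟨a, haA, SimpleGraph.Reachable.symm hax⟩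
          rw [hRt] at hxRt
          exact hxS₀ hxRt
        · change P (R t)
          rw [hRt]; exact hP₀
      · change (R t, t ∩ I (R t)) = (R s₀, s₀ ∩ I (R s₀))
        rw [hRt]
        exact Prod.ext rfl ht
  rw [fiber_eq]
  -- (L5) on the cell, the red cluster of `x` uses no edge at `S₀`
  have offcluster : ∀ t : Finset ι, t ∩ B = π → K t ⊆ K ((B \ π) ∪ (t \ B)) := by
    intro t ht
    have agree : ∀ i, i ∈ B → (i ∈ t ↔ i ∈ s₀) := by
      intro i hi
      have := congrArg (fun u : Finset ι => i ∈ u) ht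
      simp only [hπ, Finset.mem_inter, hi, and_true, eq_iff_iff] at this
      exact this
    have htr : ∀ u ∈ S₀ᶜ, ∀ w, (openGraph (ends '' (↑t : Set ι))).Adj u w →
        (openGraph (ends '' (↑(t \ B) : Set ι))).Adj u w ∧ w ∈ S₀ᶜ := by
      intro u hu w hadj
      rw [openGraph_image_adj] at hadj
      obtain ⟨⟨i, hit, hi⟩, hne⟩ := hadj
      -- the edge `i` is not at `S₀`
      have hiB : i ∉ B := by
        intro hiB
        have his₀ : i ∈ s₀ := (agree i hiB).mp hit
        have hiB' := hiB
        simp only [hB, hI, Finset.mem_filter, Finset.mem_univ, true_and] at hiB'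
        obtain ⟨v, hvS, hvi⟩ := hiB'
        rw [hi, Sym2.mem_iff] at hvi
        rcases hvi with rfl | rfl
        · exact hu hvS
        · -- `w ∈ S₀` and the red edge `i ∈ s₀` joins `w` to `u`, so `u ∈ S₀`
          have hadj₀ : (openGraph (ends '' (↑s₀ : Set ι))).Adj v u := by
            rw [openGraph_image_adj]
            exact ⟨⟨i, his₀, by rw [hi, Sym2.eq_swap]⟩, hne.symm⟩
          exact hu (R_closed s₀ hvS hadj₀)
      have hwS : w ∈ S₀ᶜ := by
        intro hwS
        exact hiB (mem_I S₀ i w hwS (by rw [hi]; exact Sym2.mem_mk_right u w))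
      refine ⟨?_, hwS⟩
      rw [openGraph_image_adj]
      exact ⟨⟨i, Finset.mem_sdiff.mpr ⟨hit, hiB⟩, hi⟩, hne⟩
    intro y hy
    obtain ⟨p⟩ := hy
    have hreach := ((reachable_transfer S₀ᶜ htr p) hxS₀).1
    exact hKmono Finset.subset_union_right hreach
  refine oneSided_cell_nonneg_of_le B π Finset.inter_subset_right F G hFm hGm (fun t => hf0 _) ?_
  intro t ht; exact hg (offcluster t ht)


end pred

section transport
variable [DecidableEq ι]

open Classical in
/-- `offCluster_oneSided_nonneg_pred` on a sub-multigraph with edge set `E'` (colourings `t ⊆ E'`, blue edges `E' ∖ t`), transported along `{i // i ∈ E'}`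
exactly as `offCluster_twoColouring_nonneg_pred_sub`.  [cite: KozmaNitzan2024, Questions 8–9 (§5.5 p. 36) (context)] -/
theorem offCluster_oneSided_nonneg_pred_sub (ends : ι → Sym2 V) (E' : Finset ι) (x : V) (A : Set V) (P : Set V → Prop) (f g : Set V → ℝ)
    (hf : Monotone f) (hf0 : ∀ W, 0 ≤ f W) (hg : Monotone g) :
    0 ≤ ∑ t ∈ E'.powerset.filter (fun t : Finset ι => (∀ a ∈ A, a ∉ openCluster (ends '' (↑t : Set ι)) x) ∧
        P {y | ∃ a ∈ A, y ∈ openCluster (ends '' (↑t : Set ι)) a}),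
      f (openCluster (ends '' (↑(E' \ t) : Set ι)) x) *
        (g (openCluster (ends '' (↑(E' \ t) : Set ι)) x) - g (openCluster (ends '' (↑t : Set ι)) x)) := by
  set emb : {i // i ∈ E'} ↪ ι := Function.Embedding.subtype _ with hemb
  have key := offCluster_oneSided_nonneg_pred (ends ∘ Subtype.val : {i // i ∈ E'} → Sym2 V) x A P f g hf hf0 hg
  have map_compl : ∀ t : Finset {i // i ∈ E'}, (tᶜ).map emb = E' \ t.map emb := by
    intro t
    ext i
    simp only [Finset.mem_map, Finset.mem_compl, Finset.mem_sdiff, hemb, Function.Embedding.coe_subtype]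
    constructor
    · rintro ⟨⟨j, hj⟩, hjt, rfl⟩
      exact ⟨hj, fun ⟨⟨k, hk⟩, hkt, hkj⟩ => hjt (by cases hkj; exact hkt)⟩
    · rintro ⟨hiE, hnot⟩
      exact ⟨⟨i, hiE⟩, fun hit => hnot ⟨⟨i, hiE⟩, hit, rfl⟩, rfl⟩
  have map_sub : ∀ t : Finset {i // i ∈ E'}, t.map emb ⊆ E' := by
    intro t i hi
    obtain ⟨⟨j, hj⟩, _, rfl⟩ := Finset.mem_map.mp hi
    exact hj
  refine key.trans_eq ?_
  refine Finset.sum_bij' (fun t _ => t.map emb) (fun t _ => t.subtype (· ∈ E')) ?_ ?_ ?_ ?_ ?_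
  · intro t ht
    rw [Finset.mem_filter] at ht ⊢
    refine ⟨Finset.mem_powerset.mpr (map_sub t), ?_⟩
    rw [← image_map_subtype]; exact ht.2
  · intro t ht
    rw [Finset.mem_filter] at ht ⊢
    refine ⟨Finset.mem_univ _, ?_⟩
    have hsub : t ⊆ E' := Finset.mem_powerset.mp ht.1
    rw [image_map_subtype, Finset.subtype_map_of_mem (fun i hi => hsub hi)]
    exact ht.2
  · intro t _
    ext ⟨i, hi⟩
    rw [Finset.mem_subtype, Finset.mem_map]
    constructor
    · rintro ⟨⟨j, hj⟩, hjt, hji⟩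
      have hji' : j = i := by simpa [hemb] using hji
      subst hji'
      exact hjt
    · intro h
      exact ⟨⟨i, hi⟩, h, by simp [hemb]⟩
  · intro t ht
    have hsub : t ⊆ E' := Finset.mem_powerset.mp (Finset.mem_filter.mp ht).1
    exact Finset.subtype_map_of_mem (fun i hi => hsub hi)
  · intro t _
    rw [image_map_subtype ends E' (tᶜ), image_map_subtype ends E' t, map_compl]

end transport

end Coefficientwise

end Summit.CriticalPhenomena.PercolationContinuityZ3.Theorems
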